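import Mathlib
import Summits.Ventures.PercRepro2.LocRows
import Summits.Ventures.PercRepro2.SwRow
import Summits.Ventures.PercRepro2.SwOut
import Summits.Ventures.PercRepro2.SwAllRow
import Summits.Ventures.PercRepro2.SwOutAll
import Summits.Ventures.PercRepro2.SwOutArmFlip
import Summits.Ventures.PercRepro2.SwOutArms
import Summits.Ventures.PercRepro2.SwOutArmOrbit
import Summits.Ventures.PercRepro2.SwOutArmCube
import Summits.Ventures.PercRepro2.SwOutArmThm
import Summits.Ventures.PercRepro2.SwOutCoreDefs
import Summits.Ventures.PercRepro2.SwOutCoreCube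
import Summits.Ventures.PercRepro2.SwOutCoreKey
import Summits.Ventures.PercRepro2.SwOutCoreShadowKey
import Summits.Ventures.PercRepro2.SwOutJunctionH1Defs
import Summits.Ventures.PercRepro2.SwOutJunctionH1Arms
import Summits.Ventures.PercRepro2.SwOutJunctionH1Kinds
import Summits.Ventures.PercRepro2.SwOutBigBlockDefs
import Summits.Ventures.PercRepro2.SwOutMixedBaseDefs
import Summits.Ventures.PercRepro2.SwOutMixedCore
import Summits.Ventures.PercRepro2.SwOutMixedCoreBlockThm
import Summits.Ventures.PercRepro2.SwOutMixedPartDefs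
import Summits.Ventures.PercRepro2.SwOutMixedPartBaseE

/-!
# The key and the blocks of a mixed single-junction class (blind cell PercRepro2, night-4 g19,
2026-08-27; proofs/NIGHT4-G19.md §6)

THE KEY of a `Q`-point of a class with a mixed single junction (`keyM`): the all-red orientation
when `u` is outside the hull of `h` or the point is escaping of the plain kind; for the core kind,
the MIXED data `(coreBaseOf ζ, uArms ζ, AhOf ζ, farArms ζ)` when the dead edges are blue at the
canonical base (`DeadBlue`) and the core key `(coreBaseOf ζ, armsC ζ)` otherwise; for an escaping
point of the mixed kind (`MixedKindE`: it lies in the block of a core-kind `Q`-point with blue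
dead edges whose data is that read off the point, `baseE`) the data read off the point.  THE
BLOCKS (`blockM`): the coarse orbit, the core cube, the mixed block `blockC` (`mixedBlock`).
The unfolding lemmas `keyM_of_out`, `keyM_of_coreMixed`, `keyM_of_coreRed`, `keyM_of_escMixed`,
`keyM_of_plain`, and `mem_mixedBlock`.
-/

namespace Summit.Ventures.PercRepro2

namespace BigBlock

open Hull LocRows

variable {V : Type*} {E : Type*} [Fintype E] [DecidableEq E]

open scoped Classical

section Defs

variable (ends : E → Sym2 V) (U : Set V) (ξ : Config E) (l h o u p : V)

/-- The dead edges are blue at the canonical base. -/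
def DeadBlue (ζ : Config E) : Prop :=
  ∀ e x, ends e = s(p, x) → x ∈ AhOf ends h u p ζ → coreBaseOf ends ζ h u e = false

/-- The data of the mixed kind: the canonical base, the u-arms, the h-piece, the far arms. -/
noncomputable def mixedData (ζ : Config E) :
    Config E × Finset (Set V) × Set V × Finset (Set V) :=
  (coreBaseOf ends ζ h u, uArms ends h u p ζ, AhOf ends h u p ζ, farArms ends h u p ζ)

/-- The mixed block of a data quadruple. -/
noncomputable def mixedBlock (d : Config E × Finset (Set V) × Set V × Finset (Set V)) :
    Finset (Config E) :=
  blockC ends d.1 u p (fun P : d.2.1 => P.1) d.2.2.1 (fun P : d.2.2.2 => P.1)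

/-- The escaping points of the mixed kind: in the block of a core-kind `Q`-point with blue dead
edges whose data is the data read off the point. -/
def MixedKindE (ζ : Config E) : Prop :=
  ∃ ζ₀ ∈ swOutSide ends l h o U ξ, CoreKind ends U h u ζ₀ ∧ DeadBlue ends h u p ζ₀ ∧
    mixedData ends h u p ζ₀ = mixedData ends h u p (baseE ends h u p ζ) ∧
    ζ ∈ mixedBlock ends u p (mixedData ends h u p ζ₀)

/-- The keys. -/
abbrev KeyM (V E : Type*) :=
  Config E ⊕ ((Config E × Finset (Set V)) ⊕ (Config E × Finset (Set V) × Set V × Finset (Set V)))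

/-- The key of a `Q`-point of a mixed single-junction class. -/
noncomputable def keyM (ζ : Config E) : KeyM V E :=
  if u ∉ hull ends ζ h then Sum.inl (allRed ends ζ h)
  else if hull ends ζ u ⊆ U then
    (if DeadBlue ends h u p ζ then Sum.inr (Sum.inr (mixedData ends h u p ζ))
     else Sum.inr (Sum.inl (coreBaseOf ends ζ h u, armsC ends h u ζ)))
  else if MixedKindE ends U ξ l h o u p ζ then
    Sum.inr (Sum.inr (mixedData ends h u p (baseE ends h u p ζ)))
  else Sum.inl (allRed ends ζ h)

/-- The block of a key: the coarse orbit, the core cube, or the mixed block. -/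
noncomputable def blockM : KeyM V E → Finset (Config E)
  | Sum.inl ρ => orbit ends ρ h
  | Sum.inr (Sum.inl (b, S)) => coreCube ends (armsFun S) b
  | Sum.inr (Sum.inr d) => mixedBlock ends u p d

end Defs

section Lemmas

variable {ends : E → Sym2 V} {U : Set V} {ξ : Config E} {l h o u p : V}

/-- The key of an out point. -/
lemma keyM_of_out {ζ : Config E} (hu : u ∉ hull ends ζ h) :
    keyM ends U ξ l h o u p ζ = Sum.inl (allRed ends ζ h) := by
  simp only [keyM, if_pos hu]

/-- The key of a core-kind point with blue dead edges. -/
lemma keyM_of_coreMixed {ζ : Config E} (hu : u ∈ hull ends ζ h) (hk : hull ends ζ u ⊆ U)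
    (hd : DeadBlue ends h u p ζ) :
    keyM ends U ξ l h o u p ζ = Sum.inr (Sum.inr (mixedData ends h u p ζ)) := by
  simp only [keyM, if_neg (not_not.2 hu), if_pos hk, if_pos hd]

/-- The key of a core-kind point with a red dead edge. -/
lemma keyM_of_coreRed {ζ : Config E} (hu : u ∈ hull ends ζ h) (hk : hull ends ζ u ⊆ U)
    (hd : ¬ DeadBlue ends h u p ζ) :
    keyM ends U ξ l h o u p ζ = Sum.inr (Sum.inl (coreBaseOf ends ζ h u, armsC ends h u ζ)) := by
  simp only [keyM, if_neg (not_not.2 hu), if_pos hk, if_neg hd]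

/-- The key of an escaping point of the mixed kind. -/
lemma keyM_of_escMixed {ζ : Config E} (hu : u ∈ hull ends ζ h) (hesc : ¬ hull ends ζ u ⊆ U)
    (hm : MixedKindE ends U ξ l h o u p ζ) :
    keyM ends U ξ l h o u p ζ = Sum.inr (Sum.inr (mixedData ends h u p (baseE ends h u p ζ))) := by
  simp only [keyM, if_neg (not_not.2 hu), if_neg hesc, if_pos hm]

/-- The key of an escaping point of the plain kind. -/
lemma keyM_of_plain {ζ : Config E} (hu : u ∈ hull ends ζ h) (hesc : ¬ hull ends ζ u ⊆ U)
    (hm : ¬ MixedKindE ends U ξ l h o u p ζ) :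
    keyM ends U ξ l h o u p ζ = Sum.inl (allRed ends ζ h) := by
  simp only [keyM, if_neg (not_not.2 hu), if_neg hesc, if_neg hm]

omit [DecidableEq E] in
/-- Membership in the mixed block of the data of a point. -/
lemma mem_mixedBlock {ζ ζ' : Config E} :
    ζ' ∈ mixedBlock ends u p (mixedData ends h u p ζ) ↔
      ∃ q : Pt (uArms ends h u p ζ) (farArms ends h u p ζ), ¬ Leak' q ∧
        mixedReal ends u p (fun P : uArms ends h u p ζ => P.1) (AhOf ends h u p ζ)
          (fun P : farArms ends h u p ζ => P.1) (coreBaseOf ends ζ h u) q = ζ' := by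
  simp only [mixedBlock, mixedData, blockC, Finset.mem_image, Finset.mem_filter, Finset.mem_univ,
    true_and]

omit [Fintype E] [DecidableEq E] in
/-- A red dead edge from the failure of `DeadBlue`. -/
lemma exists_red_dead_of_not_deadBlue {ζ : Config E} (hd : ¬ DeadBlue ends h u p ζ) :
    ∃ e x, ends e = s(p, x) ∧ x ∈ AhOf ends h u p ζ ∧ coreBaseOf ends ζ h u e = true := by
  by_contra hno
  apply hd
  intro e x hxe hx
  by_contra hne
  exact hno ⟨e, x, hxe, hx, by simpa using hne⟩

end Lemmas

end BigBlock

end Summit.Ventures.PercRepro2
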